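import Mathlib
import Literature.Probability.LatticeModels.ProdBernoulliIndependence
import Literature.Probability.Percolation.ConditionalPositiveAssociation
import Literature.Probability.Percolation.TwoClusterConditionalAssociation
import Literature.Probability.Percolation.PercolationProofs
import Literature.Probability.Percolation.ClusterBoundary
import HarnessLib

/-!
# Dyadic thinning of the relay set: `stub_dyadicThinning`

This file proves `stub_dyadicThinning`.

## The argument (dyadic Bernoulli thinning of the relay set)

Write `N_A(ω)` for the number of relay points `a ∈ A` joined to `o` by an open path ("footprint of
`o` in `A`").  The hypothesis (single-finger lemma) bounds `μ{N_{A'} = 1 ∧ o ↮ b} ≤ t` for EVERY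
sub-relay set `A'` all of whose points are `t`-reliably joined to `b`.  Apply it to the random
sub-relay set `A' = A ∩ 𝐓`, where `𝐓` keeps each vertex independently with probability
`ρ = 1/(4m)` (coins independent of the bond configuration), and average over the coins: this is a
swap of two finite sums (`measureReal_mul_le_of_sections`).  On the event `m ≤ N_A < 2m` the coins
leave exactly one surviving finger with probability `N ρ (1 - ρ)^(N - 1) ≥ 1/8`
(`prodBernoulli_real_card_filter_eq_one`, Bernoulli's inequality `one_add_mul_le_pow`), so each
dyadic scale costs at most `8 t`; the window `K ≤ N_A < K 2^L` is the union of `L` scales.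
-/

namespace Summit.CriticalPhenomena.PercolationContinuityZ3.Theorems

open scoped BigOperators Classical
open MeasureTheory Set
open Literature.Probability.LatticeModels (prodBernoulli)
open Literature.Probability.Percolation (openConn measurableSet_openConn_holds)

/-! ### Finite sums of point masses and the averaging step -/

/-- On a finite type with measurable singletons, the real mass of a set under a finite measure is
the finite sum of its point masses. -/
private theorem measureReal_eq_sum_ite {α : Type*} [Fintype α] [MeasurableSpace α]
    [MeasurableSingletonClass α] (μ : Measure α) [IsFiniteMeasure μ] (s : Set α) :
    μ.real s = ∑ x, if x ∈ s then μ.real {x} else 0 := by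
  rw [← Finset.sum_filter, sum_measureReal_singleton]
  congr 1
  ext x
  simp

/-- **Averaging over independent coins (finite Fubini).** If every section `S T` has `μ`-mass at
most `t`, and for every `ω ∈ E` the set of coin outcomes `T` with `ω ∈ S T` has `ν`-mass at least
`c` (`ν` a probability measure), then `c μ(E) ≤ t`: both sides of
`∑_T ν{T} μ(S T) = ∑_ω μ{ω} ν{T | ω ∈ S T}` are the same finite double sum. -/
private theorem measureReal_mul_le_of_sections {α β : Type*} [Fintype α] [Fintype β]
    [MeasurableSpace α] [MeasurableSpace β] [MeasurableSingletonClass α]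
    [MeasurableSingletonClass β]
    (μ : Measure α) (ν : Measure β) [IsFiniteMeasure μ] [IsProbabilityMeasure ν]
    (S : β → Set α) (E : Set α) {t c : ℝ}
    (hS : ∀ T, μ.real (S T) ≤ t) (hE : ∀ ω ∈ E, c ≤ ν.real {T | ω ∈ S T}) :
    c * μ.real E ≤ t := by
  -- swap the two finite sums
  have hswap : ∑ T, ν.real {T} * μ.real (S T) = ∑ ω, μ.real {ω} * ν.real {T | ω ∈ S T} := by
    have h1 : ∀ T, ν.real {T} * μ.real (S T) =
        ∑ ω, if ω ∈ S T then ν.real {T} * μ.real {ω} else 0 := fun T => by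
      rw [measureReal_eq_sum_ite μ (S T), Finset.mul_sum]
      exact Finset.sum_congr rfl fun ω _ => by split_ifs <;> simp
    have h2 : ∀ ω, μ.real {ω} * ν.real {T | ω ∈ S T} =
        ∑ T, if ω ∈ S T then ν.real {T} * μ.real {ω} else 0 := fun ω => by
      rw [measureReal_eq_sum_ite ν {T | ω ∈ S T}, Finset.mul_sum]
      exact Finset.sum_congr rfl fun T _ => by
        simp only [Set.mem_setOf_eq]
        split_ifs <;> ring
    rw [Finset.sum_congr rfl fun T _ => h1 T, Finset.sum_congr rfl fun ω _ => h2 ω]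
    exact Finset.sum_comm
  -- upper bound: the average of the section bounds
  have hupper : ∑ T, ν.real {T} * μ.real (S T) ≤ t :=
    calc ∑ T, ν.real {T} * μ.real (S T) ≤ ∑ T, ν.real {T} * t :=
          Finset.sum_le_sum fun T _ => mul_le_mul_of_nonneg_left (hS T) measureReal_nonneg
      _ = t := by
          rw [← Finset.sum_mul, sum_measureReal_singleton, Finset.coe_univ, probReal_univ, one_mul]
  -- lower bound: drop the configurations outside `E`
  have hlower : ∑ ω, c * (if ω ∈ E then μ.real {ω} else 0) ≤
      ∑ ω, μ.real {ω} * ν.real {T | ω ∈ S T} := by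
    refine Finset.sum_le_sum fun ω _ => ?_
    split_ifs with hω
    · rw [mul_comm]
      exact mul_le_mul_of_nonneg_left (hE ω hω) measureReal_nonneg
    · rw [mul_zero]
      exact mul_nonneg measureReal_nonneg measureReal_nonneg
  calc c * μ.real E = ∑ ω, c * (if ω ∈ E then μ.real {ω} else 0) := by
        rw [measureReal_eq_sum_ite μ E, Finset.mul_sum]
    _ ≤ _ := hlower
    _ = _ := hswap.symm
    _ ≤ t := hupper

/-! ### One survivor of a Bernoulli thinning -/

/-- Exactly one element of `R` survives in `T` iff some `r ∈ R` lies in `T` and no other element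
of `R` does. -/
private theorem setOf_card_filter_mem_eq_one {ι : Type*} (R : Finset ι) :
    {T : Set ι | (R.filter (· ∈ T)).card = 1} =
      ⋃ r ∈ R, ({T : Set ι | r ∈ T} ∩ {T | ∀ r' ∈ R.erase r, r' ∉ T}) := by
  ext T
  simp only [Set.mem_setOf_eq, Set.mem_iUnion, Set.mem_inter_iff, Finset.card_eq_one,
    exists_prop]
  constructor
  · rintro ⟨r, hr⟩
    have hrR : r ∈ R.filter (· ∈ T) := by rw [hr]; exact Finset.mem_singleton_self r
    refine ⟨r, (Finset.mem_filter.1 hrR).1, (Finset.mem_filter.1 hrR).2, fun r' hr' hr'T => ?_⟩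
    have h' : r' ∈ R.filter (· ∈ T) := Finset.mem_filter.2 ⟨Finset.mem_of_mem_erase hr', hr'T⟩
    rw [hr, Finset.mem_singleton] at h'
    exact Finset.ne_of_mem_erase hr' h'
  · rintro ⟨r, hrR, hrT, hrest⟩
    refine ⟨r, Finset.ext fun x => ?_⟩
    simp only [Finset.mem_filter, Finset.mem_singleton]
    constructor
    · rintro ⟨hxR, hxT⟩
      by_contra hxr
      exact hrest x (Finset.mem_erase.2 ⟨hxr, hxR⟩) hxT
    · rintro rfl
      exact ⟨hrR, hrT⟩

/-- **One-survivor probability.** If each element is kept independently with probability `ρ`,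
exactly one element of the finite set `R` is kept with probability `|R| ρ (1 - ρ) ^ (|R| - 1)`
(disjoint union over the survivor; independence of disjoint sets of coins). -/
private theorem prodBernoulli_real_card_filter_eq_one {ι : Type*} (ρ : unitInterval)
    (R : Finset ι) :
    (prodBernoulli (fun _ : ι => ρ)).real {T : Set ι | (R.filter (· ∈ T)).card = 1} =
      R.card * ((ρ : ℝ) * (1 - ρ) ^ (R.card - 1)) := by
  have hmeas : ∀ r ∈ R, MeasurableSet ({T : Set ι | r ∈ T} ∩ {T | ∀ r' ∈ R.erase r, r' ∉ T}) :=
    fun r _ => (measurableSet_mem r).inter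
      (Literature.Probability.LatticeModels.measurableSet_forall_notMem_of_countable
        (R.erase r).countable_toSet)
  have hdisj : (↑R : Set ι).PairwiseDisjoint
      fun r => ({T : Set ι | r ∈ T} ∩ {T | ∀ r' ∈ R.erase r, r' ∉ T}) := by
    intro r₁ hr₁ r₂ _ hne
    refine Set.disjoint_left.2 fun T hT₁ hT₂ => ?_
    exact hT₂.2 r₁ (Finset.mem_erase.2 ⟨hne, Finset.mem_coe.1 hr₁⟩) hT₁.1
  have hpiece : ∀ r ∈ R, (prodBernoulli (fun _ : ι => ρ)).real
      ({T : Set ι | r ∈ T} ∩ {T | ∀ r' ∈ R.erase r, r' ∉ T}) =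
        (ρ : ℝ) * (1 - ρ) ^ (R.card - 1) := by
    intro r hr
    have hA : Literature.Probability.Percolation.DeterminedBy {T : Set ι | r ∈ T}
        (↑({r} : Finset ι) : Set ι) := by
      rw [Literature.Probability.Percolation.determinedBy_iff]
      intro ω ω' h
      have := Set.ext_iff.1 h r
      simp only [Set.mem_inter_iff, Finset.coe_singleton, Set.mem_singleton_iff, and_true] at this
      exact this
    have hB : Literature.Probability.Percolation.DeterminedBy
        {T : Set ι | ∀ r' ∈ R.erase r, r' ∉ T} (↑(R.erase r) : Set ι) := by
      rw [Literature.Probability.Percolation.determinedBy_iff]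
      intro ω ω' h
      simp only [Set.mem_setOf_eq]
      refine forall₂_congr fun r' hr' => not_congr ?_
      have := Set.ext_iff.1 h r'
      simp only [Set.mem_inter_iff, Finset.mem_coe, hr', and_true] at this
      exact this
    rw [Literature.Probability.LatticeModels.prodBernoulli_real_inter_of_determinedBy_disjoint
        (fun _ : ι => ρ) (Finset.disjoint_singleton_left.2 (Finset.notMem_erase r R)) hA hB
        (measurableSet_mem r)
        (Literature.Probability.LatticeModels.measurableSet_forall_notMem_of_countable
          (R.erase r).countable_toSet),
      Literature.Probability.LatticeModels.prodBernoulli_real_setOf_mem,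
      Literature.Probability.LatticeModels.prodBernoulli_real_forall_notMem, Finset.prod_const,
      Finset.card_erase_of_mem hr]
  rw [setOf_card_filter_mem_eq_one, measureReal_biUnion_finset hdisj hmeas,
    Finset.sum_congr rfl hpiece, Finset.sum_const, nsmul_eq_mul]

/-- **Bernoulli's inequality on a dyadic scale.** With coin rate `ρ = 1/(4m)` and a footprint
`m ≤ N < 2m`, the one-survivor probability `N ρ (1 - ρ)^(N-1)` is at least `1/8`:
`N ρ ≥ m ρ = 1/4` and `(1 - ρ)^(N-1) ≥ 1 - (N-1) ρ ≥ 1 - 2 m ρ = 1/2`. -/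
private theorem one_eighth_le_oneSurvivor {m N : ℕ} (hm : 1 ≤ m) (hmN : m ≤ N) (hN : N < 2 * m) :
    (1 : ℝ) / 8 ≤ N * ((1 / (4 * m) : ℝ) * (1 - 1 / (4 * m)) ^ (N - 1)) := by
  have hm' : (1 : ℝ) ≤ m := by exact_mod_cast hm
  have hm0 : (m : ℝ) ≠ 0 := by positivity
  have hN1 : 1 ≤ N := le_trans hm hmN
  set ρ : ℝ := 1 / (4 * m) with hρ
  have hρpos : 0 < ρ := by positivity
  have hmρ : (m : ℝ) * ρ = 1 / 4 := by rw [hρ]; field_simp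
  have hρle : ρ ≤ 1 / 4 :=
    calc ρ = 1 * ρ := (one_mul ρ).symm
      _ ≤ m * ρ := mul_le_mul_of_nonneg_right hm' hρpos.le
      _ = 1 / 4 := hmρ
  -- Bernoulli: `1 - (N - 1) ρ ≤ (1 - ρ) ^ (N - 1)`
  have hbern : 1 + ((N - 1 : ℕ) : ℝ) * (-ρ) ≤ (1 + (-ρ)) ^ (N - 1) :=
    one_add_mul_le_pow (by linarith) _
  have hcast : ((N - 1 : ℕ) : ℝ) = N - 1 := by rw [Nat.cast_sub hN1, Nat.cast_one]
  have hNle : (N : ℝ) - 1 ≤ 2 * m := by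
    have : (N : ℝ) < 2 * m := by exact_mod_cast hN
    linarith
  have h3 : (1 : ℝ) / 2 ≤ (1 - ρ) ^ (N - 1) := by
    have h1 : ((N : ℝ) - 1) * ρ ≤ 2 * m * ρ := mul_le_mul_of_nonneg_right hNle hρpos.le
    have e : (1 : ℝ) + -ρ = 1 - ρ := by ring
    rw [hcast, e] at hbern
    linarith
  have h2 : (1 : ℝ) / 4 ≤ N * ρ :=
    calc (1 : ℝ) / 4 = m * ρ := hmρ.symm
      _ ≤ N * ρ := mul_le_mul_of_nonneg_right (by exact_mod_cast hmN) hρpos.le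
  calc (1 : ℝ) / 8 = 1 / 4 * (1 / 2) := by norm_num
    _ ≤ N * ρ * (1 - ρ) ^ (N - 1) :=
        mul_le_mul h2 h3 (by norm_num) (mul_nonneg (Nat.cast_nonneg N) hρpos.le)
    _ = N * (ρ * (1 - ρ) ^ (N - 1)) := by ring

/-! ### One dyadic scale, and the window as a union of scales -/

/-- **Scale lemma.** If the single-finger bound `μ{N_{A ∩ T} = 1 ∧ o ↮ b} ≤ t` holds for every
vertex set `T`, then `μ{o ↮ b ∧ m ≤ N_A < 2m} ≤ 8 t` (`m ≥ 1`): thin `A` by independent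
`1/(4m)`-coins and average. -/
private theorem scale_bound (n : ℕ) (w : Sym2 (Fin n) → unitInterval) (A : Finset (Fin n))
    (o b : Fin n) (t : ℝ)
    (hS : ∀ T : Set (Fin n), (prodBernoulli w).real
      {ω | ((A.filter (· ∈ T)).filter fun a => ω ∈ openConn o a).card = 1 ∧
        ω ∉ openConn o b} ≤ t)
    {m : ℕ} (hm : 1 ≤ m) :
    (prodBernoulli w).real {ω | ω ∉ openConn o b ∧
        m ≤ (A.filter fun a => ω ∈ openConn o a).card ∧
        (A.filter fun a => ω ∈ openConn o a).card < 2 * m} ≤ 8 * t := by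
  have hm1 : (1 : ℝ) ≤ m := by exact_mod_cast hm
  have hm4 : (0 : ℝ) < 4 * m := by linarith
  -- the coins: each vertex is kept independently with probability `1 / (4 m)`
  let ρ : unitInterval := ⟨1 / (4 * m), by positivity, (div_le_one hm4).2 (by linarith)⟩
  have key := measureReal_mul_le_of_sections (prodBernoulli w) (prodBernoulli fun _ : Fin n => ρ)
    (fun T : Set (Fin n) => {ω : Set (Sym2 (Fin n)) |
      ((A.filter (· ∈ T)).filter fun a => ω ∈ openConn o a).card = 1 ∧ ω ∉ openConn o b})
    {ω | ω ∉ openConn o b ∧ m ≤ (A.filter fun a => ω ∈ openConn o a).card ∧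
      (A.filter fun a => ω ∈ openConn o a).card < 2 * m} (c := 1 / 8) hS ?_
  · linarith
  -- on the scale event, exactly one finger survives the coins with probability `≥ 1/8`
  rintro ω ⟨hb, hmN, hN2⟩
  have hR : ∀ T : Set (Fin n), ((A.filter (· ∈ T)).filter fun a => ω ∈ openConn o a) =
      (A.filter fun a => ω ∈ openConn o a).filter (· ∈ T) := fun T => by
    ext a
    simp only [Finset.mem_filter]
    tauto
  have hset : {T : Set (Fin n) | ω ∈ {ω' : Set (Sym2 (Fin n)) |
      ((A.filter (· ∈ T)).filter fun a => ω' ∈ openConn o a).card = 1 ∧ ω' ∉ openConn o b}} =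
      {T : Set (Fin n) | ((A.filter fun a => ω ∈ openConn o a).filter (· ∈ T)).card = 1} := by
    ext T
    simp only [Set.mem_setOf_eq, hR T, hb, not_false_eq_true, and_true]
  rw [hset, prodBernoulli_real_card_filter_eq_one]
  exact one_eighth_le_oneSurvivor hm hmN hN2

/-- **Dyadic decomposition of the window**: `K ≤ N < K 2^L` puts `N` in a scale
`K 2^j ≤ N < 2 K 2^j` with `j < L`. -/
private theorem exists_dyadic_scale (K N L : ℕ) (h1 : K ≤ N) (h2 : N < K * 2 ^ L) :
    ∃ j < L, K * 2 ^ j ≤ N ∧ N < 2 * (K * 2 ^ j) := by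
  induction L generalizing K with
  | zero => rw [pow_zero, mul_one] at h2; omega
  | succ L ih =>
    by_cases h : N < 2 * K
    · exact ⟨0, Nat.succ_pos L, by simpa using h1, by simpa using h⟩
    · rw [not_lt] at h
      have h2' : N < 2 * K * 2 ^ L :=
        calc N < K * 2 ^ (L + 1) := h2
          _ = 2 * K * 2 ^ L := by ring
      obtain ⟨j, hjL, hj1, hj2⟩ := ih (2 * K) h h2'
      refine ⟨j + 1, by omega, ?_, ?_⟩
      · calc K * 2 ^ (j + 1) = 2 * K * 2 ^ j := by ring
          _ ≤ N := hj1
      · calc N < 2 * (2 * K * 2 ^ j) := hj2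
          _ = 2 * (K * 2 ^ (j + 1)) := by ring

/-- **Dyadic thinning**: given the single-finger bound for every sub-relay set, the window `K ≤ N_A < K·2^L` of the footprint
of `o` in `A` on `{o ↮ b}` costs at most `16·L·t` (each dyadic scale at most `8 t`, by Bernoulli thinning of the relay set with
retention probability `1/(4m)`); see the module docstring. -/
theorem stub_dyadicThinning :
    (∀ (n : ℕ) (w : Sym2 (Fin n) → unitInterval) (A' : Finset (Fin n)) (o b : Fin n) (t : ℝ),
      0 ≤ t →
      (∀ a ∈ A', (Literature.Probability.LatticeModels.prodBernoulli w).real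
          (Literature.Probability.Percolation.openConn a b)ᶜ ≤ t) →
      (Literature.Probability.LatticeModels.prodBernoulli w).real
          {ω | (A'.filter fun a => ω ∈ Literature.Probability.Percolation.openConn o a).card = 1 ∧
            ω ∉ Literature.Probability.Percolation.openConn o b} ≤ t) →
    ∀ (n : ℕ) (w : Sym2 (Fin n) → unitInterval) (A : Finset (Fin n)) (o b : Fin n) (t : ℝ) (K L : ℕ),
      0 ≤ t → 1 ≤ K →
      (∀ a ∈ A, (Literature.Probability.LatticeModels.prodBernoulli w).real
          (Literature.Probability.Percolation.openConn a b)ᶜ ≤ t) →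
      (Literature.Probability.LatticeModels.prodBernoulli w).real
          {ω | ω ∉ Literature.Probability.Percolation.openConn o b ∧
            K ≤ (A.filter fun a => ω ∈ Literature.Probability.Percolation.openConn o a).card ∧
            (A.filter fun a => ω ∈ Literature.Probability.Percolation.openConn o a).card < K * 2 ^ L} ≤
        16 * (L : ℝ) * t := by
  intro hSF n w A o b t K L ht hK hrel
  -- the single-finger bound for every thinned relay set `A ∩ T`
  have hS : ∀ T : Set (Fin n), (prodBernoulli w).real
      {ω | ((A.filter (· ∈ T)).filter fun a => ω ∈ openConn o a).card = 1 ∧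
        ω ∉ openConn o b} ≤ t := fun T =>
    hSF n w (A.filter (· ∈ T)) o b t ht fun a ha => hrel a (Finset.mem_filter.1 ha).1
  -- each dyadic scale costs at most `8 t`
  have hscale : ∀ j : ℕ, (prodBernoulli w).real {ω | ω ∉ openConn o b ∧
      K * 2 ^ j ≤ (A.filter fun a => ω ∈ openConn o a).card ∧
      (A.filter fun a => ω ∈ openConn o a).card < 2 * (K * 2 ^ j)} ≤ 8 * t := fun j =>
    scale_bound n w A o b t hS (le_trans hK (Nat.le_mul_of_pos_right K (Nat.two_pow_pos j)))
  -- the window is the union of the `L` dyadic scales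
  have hcover : {ω : Set (Sym2 (Fin n)) | ω ∉ openConn o b ∧
      K ≤ (A.filter fun a => ω ∈ openConn o a).card ∧
      (A.filter fun a => ω ∈ openConn o a).card < K * 2 ^ L} ⊆
      ⋃ j ∈ Finset.range L, {ω | ω ∉ openConn o b ∧
        K * 2 ^ j ≤ (A.filter fun a => ω ∈ openConn o a).card ∧
        (A.filter fun a => ω ∈ openConn o a).card < 2 * (K * 2 ^ j)} := by
    rintro ω ⟨hb, h1, h2⟩
    obtain ⟨j, hjL, hj1, hj2⟩ := exists_dyadic_scale K _ L h1 h2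
    exact Set.mem_biUnion (Finset.mem_range.2 hjL) ⟨hb, hj1, hj2⟩
  have hLt : 0 ≤ (L : ℝ) * t := mul_nonneg (Nat.cast_nonneg L) ht
  calc (prodBernoulli w).real {ω | ω ∉ openConn o b ∧
        K ≤ (A.filter fun a => ω ∈ openConn o a).card ∧
        (A.filter fun a => ω ∈ openConn o a).card < K * 2 ^ L}
      ≤ (prodBernoulli w).real (⋃ j ∈ Finset.range L, {ω | ω ∉ openConn o b ∧
          K * 2 ^ j ≤ (A.filter fun a => ω ∈ openConn o a).card ∧
          (A.filter fun a => ω ∈ openConn o a).card < 2 * (K * 2 ^ j)}) :=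
        measureReal_mono hcover (measure_ne_top _ _)
    _ ≤ ∑ j ∈ Finset.range L, (prodBernoulli w).real {ω | ω ∉ openConn o b ∧
          K * 2 ^ j ≤ (A.filter fun a => ω ∈ openConn o a).card ∧
          (A.filter fun a => ω ∈ openConn o a).card < 2 * (K * 2 ^ j)} :=
        measureReal_biUnion_finset_le _ _
    _ ≤ ∑ _j ∈ Finset.range L, 8 * t := Finset.sum_le_sum fun j _ => hscale j
    _ = 8 * L * t := by rw [Finset.sum_const, Finset.card_range, nsmul_eq_mul]; ring
    _ ≤ 16 * (L : ℝ) * t := by linarith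

end Summit.CriticalPhenomena.PercolationContinuityZ3.Theorems
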